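import Mathlib

/-!
# A1Multigrading — (A0.6) of Tier-4 sub-claim A1: one correspondence acts on a wedge monomial by
the product of its eigenvalues

Cell pub-hodge-repro2, seat p7 (sole filer). Companion of `route/T4-A1-p7.md` (A0.6): on
`H^*(B, ℂ) = ⋀^* H^1(B, ℂ)` the pull-back `[x]^*` along the endomorphism `[x] = ι_B(x)` is the algebra
map induced by its action on `H^1`; if `H^1(B, ℂ) = ⊕_σ V_σ` with `[x]^* = σ(x)` on `V_σ`, then a wedge
monomial with `k_σ` factors from `V_σ` is an eigenvector with eigenvalue `χ_k(x) = ∏_σ σ(x)^{k_σ}`.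

* `map_prod_ι_of_eq_smul` — for a linear endomorphism `f` of `M` and a list of eigenvectors
  `f (v j) = c j • v j`, the induced algebra map `ExteriorAlgebra.map f` sends the wedge monomial
  `∏_j ι (v j)` to `(∏_j c j) • ∏_j ι (v j)`.
* `map_prod_ι_eigenvalue` — the same with the eigenvalue written as `∏_σ (a σ)^{k σ}` when the
  eigenvalue of the `j`-th factor is `a (s j)` (`s j` = the eigenspace index of the `j`-th vector), i.e.
  `χ_k(x)` with `k_σ = #{j : s j = σ}`.

Standard axioms only; imports Mathlib only.
-/

namespace Summit.Ventures.HodgeRepro2.A1Multigrading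

open ExteriorAlgebra

variable {R M : Type*} [CommRing R] [AddCommGroup M] [Module R M]

/-- A list product of scalar multiples in an `R`-algebra is the product of the scalars times the
product of the elements. -/
theorem list_prod_smul {A : Type*} [Ring A] [Algebra R A] (l : List (R × A)) :
    (l.map fun p => p.1 • p.2).prod = (l.map Prod.fst).prod • (l.map Prod.snd).prod := by
  induction l with
  | nil => simp
  | cons p l ih =>
    simp only [List.map_cons, List.prod_cons, ih]
    rw [smul_mul_smul_comm]

/-- (A0.6): if `f (v j) = c j • v j` for every index `j` of the list `l`, then the algebra map
`ExteriorAlgebra.map f` multiplies the wedge monomial `∏_{j ∈ l} ι (v j)` by `∏_{j ∈ l} c j`. -/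
theorem map_prod_ι_of_eq_smul {ι' : Type*} (f : M →ₗ[R] M) (v : ι' → M) (c : ι' → R)
    (h : ∀ j, f (v j) = c j • v j) (l : List ι') :
    ExteriorAlgebra.map f (l.map fun j => ι R (v j)).prod =
      (l.map c).prod • (l.map fun j => ι R (v j)).prod := by
  rw [map_list_prod, List.map_map]
  have : ((ExteriorAlgebra.map f) ∘ fun j => ι R (v j)) = fun j => c j • ι R (v j) := by
    funext j
    simp [Function.comp, ExteriorAlgebra.map_apply_ι, h j]
  rw [this]
  have h2 := list_prod_smul (R := R) (A := ExteriorAlgebra R M) (l.map fun j => (c j, ι R (v j)))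
  simp only [List.map_map, Function.comp_def] at h2
  exact h2

/-- (A0.6), eigenvalue form: when the `j`-th vector lies in the `s j`-eigenspace with eigenvalue
`a (s j)`, the monomial eigenvalue is `∏_σ (a σ)^{k σ}` with `k σ := #{j ∈ l : s j = σ}`
(the prose's `χ_k(x) = ∏_σ σ(x)^{k_σ}`). -/
theorem map_prod_ι_eigenvalue {ι' S : Type*} [DecidableEq S] [Fintype S] (f : M →ₗ[R] M)
    (v : ι' → M) (s : ι' → S) (a : S → R) (h : ∀ j, f (v j) = a (s j) • v j) (l : List ι') :
    ExteriorAlgebra.map f (l.map fun j => ι R (v j)).prod =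
      (∏ σ : S, a σ ^ (l.map s).count σ) • (l.map fun j => ι R (v j)).prod := by
  rw [map_prod_ι_of_eq_smul f v (fun j => a (s j)) h l]
  congr 1
  -- (l.map (a ∘ s)).prod = ∏ σ, a σ ^ count σ (l.map s)
  rw [show (l.map fun j => a (s j)) = (l.map s).map a from by simp [List.map_map, Function.comp_def]]
  induction (l.map s) with
  | nil => simp
  | cons σ₀ t ih =>
    simp only [List.map_cons, List.prod_cons, List.count_cons, ih, pow_add, Finset.prod_mul_distrib]
    have hQ : (∏ x : S, a x ^ (if (σ₀ == x) = true then 1 else 0)) = a σ₀ := by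
      have : ∀ x : S, a x ^ (if (σ₀ == x) = true then 1 else 0) = if σ₀ = x then a x else 1 := by
        intro x
        by_cases hx : σ₀ = x <;> simp [hx]
      simp only [this, Finset.prod_ite_eq, Finset.mem_univ, if_true]
    rw [hQ, mul_comm]

end Summit.Ventures.HodgeRepro2.A1Multigrading
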